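import Summits.AtomisticToContinuum.Crystallization.Theorems.ChargedEnergyGapBarlowCellCount
import HarnessLib

/-!
# Charged energy gap — lens-3 g64, node «BarlowRef» (R3) — part 12 (addendum, imports the landed part 5 only): BRICK UPPER COUNTS + the isometry dictionary

Part 5 (`…BarlowCellCount`) counts the sites of a Barlow stacking in a ball FROM BELOW (`ball_volume_le_card_mul`: the bricks of the
sites within `R` COVER `B̄(q₀, R − D)`; subadditivity only).  This part counts them FROM ABOVE with the SAME cell volume
`V(a,h) = a·(a√3/2)·h` — the container bound every certified numerator of `TubeShareBoundH` needs (HANDOFF g65 item 2 (S)(T): targets per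
source, sources per member), so that in the ratio `load / N` the stacking's own cell volume cancels up to one factor (one stacking ⇒ one density):

* ★ `index_eq_of_mem_brick` — a point of `brick k i j` has index `(k, i, j)` (floor arithmetic inverse to part 5's `mem_brick_of`), hence
  ★ `brick_disjoint` — the brick wall is a partition of space;
* `brick_eq_preimage`, `measurableSet_brick`, ★ `volume_brick_eq` — a brick is the preimage of a half-open coordinate box and has volume
  EXACTLY `a·(a√3/2)·h`;
* ★★ `card_mul_le_volume` — if the bricks of the sites of a finite index set `I` lie inside `K` then `#I · V(a,h) ≤ volume K` (disjoint union),
  `brick_subset_closedBall` / `brick_subset_cthickening` (a brick lies within the box diagonal `D` of its corner site), and the two record shapes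
  ★★ `card_mul_le_ball_volume` (`#{sites within R of q₀} · V ≤ (4π/3)(R + D)³`) and `card_mul_le_volume_cthickening` (sites in `K` ⟹
  `# · V ≤ volume (cthickening D K)` — half-balls, cored balls, shadow cylinders of parts 8/10 are consumed through this one);
* the ISOMETRY DICTIONARY for `IsBarlowImage S` (`S = g '' barlowStacking a h s`, `g` an isometry): by the TREE's `isometry_surjective`
  (`…LabelledCovering`: an isometry of `E3` is onto) every centre `q` is `g x₀`, and `hg.dist_eq` / Mathlib's `Isometry.preimage_closedBall` pull
  containers back exactly; ★★ `card_mul_le_of_subset_barlowImage` — for ANY centre `q ∈ E3`, `R ≥ 0` and finite `T ⊆ g '' barlowStacking a h s ∩ B̄(q, R)`: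
  `#T · V(a,h) ≤ (4π/3)(R + 9/5)³` (window diagonal `D = 9/5` from part 5's `window_brick_diag`) — the prover works INSIDE the `IsBarlowImage`
  existential (one `obtain ⟨a, h, s, g, …⟩`), in stacking coordinates, with lower AND upper counts at the same `V(a,h)`.

0 sorry; standard axioms.
-/

noncomputable section

open scoped Classical ENNReal
open MeasureTheory
open Literature.MathematicalPhysics.StatisticalMechanics Literature.Geometry.DiscreteGeometry
open Summit.AtomisticToContinuum.Crystallization.Theses.PricedLinkCensus
open Summit.AtomisticToContinuum.Crystallization.Theorems.ChargedEnergyGapNegative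

namespace Summit.AtomisticToContinuum.Crystallization.Theorems.ChargedEnergyGapChartDial

section BrickUpper

variable (a h : ℝ) (s : ℤ → ℤ)

/-- ★ INDEX RECOVERY: a point of `brick k i j` has `(layerOf, rowOf, colOf) = (k, i, j)` (inverse to `mem_brick_of`). -/
theorem index_eq_of_mem_brick (ha : 0 < a) (hh : 0 < h) {k i j : ℤ} {x : E3} (hx : x ∈ brick a h s k i j) :
    layerOf h x = k ∧ rowOf a h s x = i ∧ colOf a h s x = j := by
  have hc : 0 < a * √3 / 2 := by positivity
  have h2 := hx 2
  have h1 := hx 1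
  have h0 := hx 0
  simp only [barlowPos_apply_two, brickSides_two] at h2
  simp only [barlowPos_apply_one, brickSides_one] at h1
  simp only [barlowPos_apply_zero, brickSides_zero] at h0
  have hk : layerOf h x = k := by
    unfold layerOf
    rw [Int.floor_eq_iff]
    constructor
    · rw [le_div_iff₀ hh]; linarith [h2.1]
    · rw [div_lt_iff₀ hh]; linarith [h2.2]
  have hj : colOf a h s x = j := by
    unfold colOf
    rw [hk, Int.floor_eq_iff]
    constructor
    · have e : ((j : ℝ) + (haggLabel s k : ℝ) / 3) * (a * √3 / 2) ≤ x 1 := by linarith [h1.1]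
      have := (le_div_iff₀ hc).2 e
      linarith
    · have e : x 1 < ((j : ℝ) + 1 + (haggLabel s k : ℝ) / 3) * (a * √3 / 2) := by linarith [h1.2]
      have := (div_lt_iff₀ hc).2 e
      linarith
  have hi : rowOf a h s x = i := by
    unfold rowOf
    rw [hj, hk, Int.floor_eq_iff]
    constructor
    · have e : ((i : ℝ) + (j : ℝ) / 2 + (haggLabel s k : ℝ) / 2) * a ≤ x 0 := by linarith [h0.1]
      have := (le_div_iff₀ ha).2 e
      linarith
    · have e : x 0 < ((i : ℝ) + 1 + (j : ℝ) / 2 + (haggLabel s k : ℝ) / 2) * a := by linarith [h0.2]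
      have := (div_lt_iff₀ ha).2 e
      linarith
  exact ⟨hk, hi, hj⟩

/-- ★ The bricks are pairwise DISJOINT (with `mem_brick_of`: the brick wall is a partition of space). -/
theorem brick_disjoint (ha : 0 < a) (hh : 0 < h) {t t' : ℤ × ℤ × ℤ} (hne : t ≠ t') :
    Disjoint (brick a h s t.1 t.2.1 t.2.2) (brick a h s t'.1 t'.2.1 t'.2.2) := by
  rw [Set.disjoint_left]
  intro x hx hx'
  obtain ⟨hk, hi, hj⟩ := index_eq_of_mem_brick a h s ha hh hx
  obtain ⟨hk', hi', hj'⟩ := index_eq_of_mem_brick a h s ha hh hx'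
  exact hne (Prod.ext (hk.symm.trans hk') (Prod.ext (hi.symm.trans hi') (hj.symm.trans hj')))

/-- A brick is the preimage (under the coordinate map) of a half-open coordinate box. -/
theorem brick_eq_preimage (k i j : ℤ) : brick a h s k i j =
    (WithLp.ofLp : E3 → (Fin 3 → ℝ)) ⁻¹'
      Set.pi Set.univ (fun m => Set.Ico (barlowPos a h s k i j m) (barlowPos a h s k i j m + brickSides a h m)) := by
  ext x
  simp only [brick, Set.mem_setOf_eq, Set.mem_preimage, Set.mem_pi, Set.mem_univ, true_implies, Set.mem_Ico]

/-- Bricks are measurable. -/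
theorem measurableSet_brick (k i j : ℤ) : MeasurableSet (brick a h s k i j) := by
  rw [brick_eq_preimage]
  exact (MeasurableSet.univ_pi fun _ => measurableSet_Ico).preimage (PiLp.volume_preserving_ofLp (Fin 3)).measurable

/-- ★ EXACT VOLUME of a brick: `a · (a√3/2) · h` (`a ≥ 0`; for `h < 0` both sides vanish). -/
theorem volume_brick_eq (ha : 0 ≤ a) (k i j : ℤ) :
    volume (brick a h s k i j) = ENNReal.ofReal (a * (a * √3 / 2) * h) := by
  rw [brick_eq_preimage, (PiLp.volume_preserving_ofLp (Fin 3)).measure_preimage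
    (MeasurableSet.univ_pi fun _ => measurableSet_Ico).nullMeasurableSet, Real.volume_pi_Ico, Fin.prod_univ_three]
  simp only [add_sub_cancel_left, brickSides_zero, brickSides_one, brickSides_two]
  have h1 : 0 ≤ a * √3 / 2 := by positivity
  rw [← ENNReal.ofReal_mul ha, ← ENNReal.ofReal_mul (mul_nonneg ha h1)]

/-- ★★ THE BRICK UPPER COUNT: if the bricks of the sites of a finite index set `I` all lie inside `K`, then `#I · a(a√3/2)h ≤ volume K`
(the bricks are disjoint and each has exactly the cell volume). -/
theorem card_mul_le_volume (ha : 0 < a) (hh : 0 < h) (I : Finset (ℤ × ℤ × ℤ)) (K : Set E3)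
    (hK : ∀ t ∈ I, brick a h s t.1 t.2.1 t.2.2 ⊆ K) :
    (I.card : ℝ≥0∞) * ENNReal.ofReal (a * (a * √3 / 2) * h) ≤ volume K := by
  calc (I.card : ℝ≥0∞) * ENNReal.ofReal (a * (a * √3 / 2) * h)
      = ∑ t ∈ I, volume (brick a h s t.1 t.2.1 t.2.2) := by
        rw [Finset.sum_congr rfl fun t _ => volume_brick_eq a h s ha.le t.1 t.2.1 t.2.2, Finset.sum_const, nsmul_eq_mul]
    _ = volume (⋃ t ∈ I, brick a h s t.1 t.2.1 t.2.2) :=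
        (measure_biUnion_finset (fun t _ t' _ hne => brick_disjoint a h s ha hh hne)
          fun t _ => measurableSet_brick a h s t.1 t.2.1 t.2.2).symm
    _ ≤ volume K := measure_mono (Set.iUnion₂_subset hK)

/-- A brick whose corner site is within `R` of `q₀` lies inside `B̄(q₀, R + D)` (`D² ≥ a² + 3a²/4 + h²`, `D ≥ 0`). -/
theorem brick_subset_closedBall {D : ℝ} (hD0 : 0 ≤ D) (hD : a ^ 2 + 3 * a ^ 2 / 4 + h ^ 2 ≤ D ^ 2) {q₀ : E3} {R : ℝ}
    {k i j : ℤ} (ht : dist (barlowPos a h s k i j) q₀ ≤ R) : brick a h s k i j ⊆ Metric.closedBall q₀ (R + D) := by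
  intro x hx
  rw [Metric.mem_closedBall]
  calc dist x q₀ ≤ dist x (barlowPos a h s k i j) + dist (barlowPos a h s k i j) q₀ := dist_triangle _ _ _
    _ ≤ D + R := add_le_add (dist_le_of_mem_brick a h s hD0 hD hx) ht
    _ = R + D := add_comm _ _

/-- A brick whose corner site lies in `K` lies inside the closed `D`-thickening of `K`. -/
theorem brick_subset_cthickening {D : ℝ} (hD0 : 0 ≤ D) (hD : a ^ 2 + 3 * a ^ 2 / 4 + h ^ 2 ≤ D ^ 2) {K : Set E3}
    {k i j : ℤ} (ht : barlowPos a h s k i j ∈ K) : brick a h s k i j ⊆ Metric.cthickening D K := by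
  intro x hx
  refine Metric.mem_cthickening_of_dist_le x (barlowPos a h s k i j) D K ht ?_
  exact dist_le_of_mem_brick a h s hD0 hD hx

/-- ★★ UPPER BALL COUNT (stacking coordinates): `#{sites within R of q₀} · a(a√3/2)h ≤ (4π/3)(R + D)³` (`R, D ≥ 0`, `D² ≥ a² + 3a²/4 + h²`). -/
theorem card_mul_le_ball_volume (ha : 0 < a) (hh : 0 < h) {D : ℝ} (hD0 : 0 ≤ D) (hD : a ^ 2 + 3 * a ^ 2 / 4 + h ^ 2 ≤ D ^ 2)
    (q₀ : E3) {R : ℝ} (hR : 0 ≤ R) (I : Finset (ℤ × ℤ × ℤ)) (hI : ∀ t ∈ I, dist (barlowPos a h s t.1 t.2.1 t.2.2) q₀ ≤ R) :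
    (I.card : ℝ) * (a * (a * √3 / 2) * h) ≤ 4 * Real.pi / 3 * (R + D) ^ 3 := by
  have hV0 : 0 ≤ a * (a * √3 / 2) * h := by positivity
  have hRD : 0 ≤ R + D := add_nonneg hR hD0
  have h1 := card_mul_le_volume a h s ha hh I (Metric.closedBall q₀ (R + D)) fun t ht => brick_subset_closedBall a h s hD0 hD (hI t ht)
  rw [EuclideanSpace.volume_closedBall_fin_three, ← ENNReal.ofReal_pow hRD, ← ENNReal.ofReal_mul (pow_nonneg hRD 3),
    ← ENNReal.ofReal_natCast, ← ENNReal.ofReal_mul (Nat.cast_nonneg _),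
    ENNReal.ofReal_le_ofReal_iff (mul_nonneg (pow_nonneg hRD 3) (by positivity))] at h1
  linarith

/-- UPPER COUNT IN A THICKENED CONTAINER (stacking coordinates): sites in `K` ⟹ `# · a(a√3/2)h ≤ volume (cthickening D K)` — the shape through
which half-balls, cored balls and shadow cylinders are consumed (their thickenings' volumes are then bounded by hand). -/
theorem card_mul_le_volume_cthickening (ha : 0 < a) (hh : 0 < h) {D : ℝ} (hD0 : 0 ≤ D) (hD : a ^ 2 + 3 * a ^ 2 / 4 + h ^ 2 ≤ D ^ 2)
    (K : Set E3) (I : Finset (ℤ × ℤ × ℤ)) (hI : ∀ t ∈ I, barlowPos a h s t.1 t.2.1 t.2.2 ∈ K) :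
    (I.card : ℝ≥0∞) * ENNReal.ofReal (a * (a * √3 / 2) * h) ≤ volume (Metric.cthickening D K) :=
  card_mul_le_volume a h s ha hh I _ fun t ht => brick_subset_cthickening a h s hD0 hD (hI t ht)

/-- ★★ UPPER BALL COUNT IN A BARLOW IMAGE: for `g` an isometry, window data `(a, h)`, ANY centre `q ∈ E3`, `R ≥ 0` and finite
`T ⊆ g '' barlowStacking a h s ∩ B̄(q, R)`: `#T · a(a√3/2)h ≤ (4π/3)(R + 9/5)³` — the same cell volume as the lower count of part 5. -/
theorem card_mul_le_of_subset_barlowImage {a h : ℝ} {s : ℤ → ℤ} {g : E3 → E3}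
    (ha : 9 / 10 ≤ a ∧ a ≤ 11 / 10) (hh : 0 < h ∧ 27 / 50 * a ^ 2 ≤ h ^ 2 ∧ h ^ 2 ≤ 121 / 150 * a ^ 2) (hg : Isometry g)
    (q : E3) {R : ℝ} (hR : 0 ≤ R) (T : Finset E3) (hT : ↑T ⊆ g '' barlowStacking a h s ∩ Metric.closedBall q R) :
    (T.card : ℝ) * (a * (a * √3 / 2) * h) ≤ 4 * Real.pi / 3 * (R + 9 / 5) ^ 3 := by
  have ha0 : 0 < a := by linarith [ha.1]
  obtain ⟨x₀, rfl⟩ := isometry_surjective hg q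
  -- pull every element of `T` back to its (unique) index
  have hidx : ∀ p ∈ T, ∃ t : ℤ × ℤ × ℤ, g (barlowPos a h s t.1 t.2.1 t.2.2) = p ∧ dist (barlowPos a h s t.1 t.2.1 t.2.2) x₀ ≤ R := by
    intro p hp
    obtain ⟨⟨y, hy, rfl⟩, hball⟩ := hT (Finset.mem_coe.2 hp)
    obtain ⟨k, i, j, rfl⟩ := hy
    refine ⟨(k, i, j), rfl, ?_⟩
    rw [Metric.mem_closedBall, hg.dist_eq] at hball
    exact hball
  choose! idx hidx1 hidx2 using hidx
  have hinj : Set.InjOn idx ↑T := by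
    intro p hp p' hp' he
    rw [← hidx1 p (Finset.mem_coe.1 hp), ← hidx1 p' (Finset.mem_coe.1 hp'), he]
  have hcard : (T.image idx).card = T.card := Finset.card_image_of_injOn hinj
  have hI : ∀ t ∈ T.image idx, dist (barlowPos a h s t.1 t.2.1 t.2.2) x₀ ≤ R := by
    intro t ht
    obtain ⟨p, hp, rfl⟩ := Finset.mem_image.1 ht
    exact hidx2 p hp
  have := card_mul_le_ball_volume a h s ha0 hh.1 (by norm_num : (0 : ℝ) ≤ 9 / 5) (window_brick_diag ha hh) x₀ hR (T.image idx) hI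
  rwa [hcard] at this

end BrickUpper

end Summit.AtomisticToContinuum.Crystallization.Theorems.ChargedEnergyGapChartDial

end
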